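import Literature.MathematicalPhysics.QuantumLattice.Imbrie2016.ScalingWindow
import Literature.MathematicalPhysics.QuantumLattice.Imbrie2016.EigenvalueScaling
import Literature.MathematicalPhysics.QuantumLattice.Imbrie2016.SmallGapDictionary
import Literature.MathematicalPhysics.QuantumLattice.Imbrie2016.AdmissibleVolume
import Literature.MathematicalPhysics.QuantumLattice.Imbrie2016.ChainBallLaw

/-!
# Imbrie (2016), Assumption LLA: a shift-0 small-gap law for the chain (1.1) is an all-shifts two-level window law

CITATION HEADER (lean-in-tree rule 2026-08-18). J. Z. Imbrie, *On many-body localization for quantum spin chains*,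
J. Stat. Phys. **163** (2016) 998–1048, doi 10.1007/s10955-016-1508-x, arXiv:1403.7837 [ImbrieJSP2016], eq. (1.1) (the box
Hamiltonian `H γ p` of `LLA.lean`, LINEAR in the coupling triple `t = (h, Γ, J)`, `SmallGapDictionary.H_smul`), p. 1000
(admissible laws: densities `≤ ρ₀` on `[-1, 1]`), eq. (1.3) = (5.2) (Assumption LLA(ν, C), an event of the MINIMAL gap).

WHAT IS PROVED (audit cell `pub-imbrie`, LLA.md block WE10 (d); NOT a statement of the paper). For the chain (1.1) in a box
of `n` sites and a pair of level indices `p ≠ q`, let `levelDiff γ n p q t = |E_q(t) - E_p(t)|` (ordered spectrum `eigs`).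
* `levelDiff_posHomogeneous`: `levelDiff` is positively homogeneous of degree one in `t` (linearity of (1.1) +
  `EigenvalueScaling`);  `cube_starShaped`: the coupling cube `[-1,1]^n × [-1,1]^n × [-1,1]^(n+1)` is star-shaped
  (dimension `3n+1` and the Haar instances are `ChainBallLaw.finrank_triple`, `ChainBallLaw.volume_triple_isAddHaarMeasure`).
* `volume_subLevel_le_of_smallGap_law`: a linear SHIFT-0 law for Lebesgue measure on the cube,
  `Leb {t ∈ cube | SmallGap γ δ t} ≤ A δ` for all `δ > 0` (this is LLA(ν = 1) for the UNIFORM laws on `[-1,1]`, up to the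
  normalisation `2^(3n+1)` of the uniform density), bounds every pair's sub-level set: `Leb {t ∈ cube | levelDiff ≤ s} ≤ A s`.
* `boxMeasure_levelDiff_window_le` (THE STATEMENT): under that shift-0 law, for EVERY admissible law family `L` (density
  bound `ρ₀ ≥ 0`), every position `a`, every pair `p ≠ q`, every shift `y ≥ 0` and width `η > 0`,
      `P_L ( y ≤ |E_q - E_p| ≤ y + η ) ≤ ρ₀^(3n+1) · A · (3n+1) · η`,
  given measurability of `t ↦ |E_q(t) - E_p(t)|` (true — ordered eigenvalues are continuous — but not formalised here and
  therefore carried as an explicit hypothesis). Proof: `AdmissibleVolume.boxMeasure_apply_le` + the scaling lemma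
  `ScalingWindow.measure_Icc_window_le_of_shift_zero`.
MEANING: in this problem two-level bounds at distinct energies (decorrelation / Minami-at-a-shift) are consequences of the
min-gap law through homogeneity, with only the polynomial factor `3n+1` and the LLA-shaped factor `ρ₀^(3n+1)`.
STATUS: the shift-0 law is a HYPOTHESIS here; nothing is claimed about LLA, which remains an OPEN, UNPROVED hypothesis of
Thm 1.1. No `sorry`, no new axioms.
-/

noncomputable section
open _root_.MeasureTheory Set Filter
open scoped ENNReal Topology Pointwise

namespace Literature.MathematicalPhysics.QuantumLattice.Imbrie2016

open SmallGapDictionary (Triple)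
open ChainBallLaw (finrank_triple)

/-- [cite: ImbrieJSP2016, eq. (1.1), (1.3)] the level difference `|E_q(t) - E_p(t)|` of the box Hamiltonian as a function of
the coupling triple. -/
def levelDiff (γ : ℝ) (n : ℕ) (p q : Cfg n) : Triple n → ℝ :=
  fun t => |eigs γ (Params.ofTriple t) q - eigs γ (Params.ofTriple t) p|

/-- [cite: ImbrieJSP2016, p. 1000] the coupling cube `[-1,1]^n × [-1,1]^n × [-1,1]^(n+1)` (support of admissible laws),
written exactly as in `AdmissibleVolume.boxMeasure_apply_le`. -/
def cube (n : ℕ) : Set (Triple n) :=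
  (Set.univ.pi fun _ : Fin n => Set.Icc (-1 : ℝ) 1) ×ˢ
    ((Set.univ.pi fun _ : Fin n => Set.Icc (-1 : ℝ) 1) ×ˢ (Set.univ.pi fun _ : Fin (n + 1) => Set.Icc (-1 : ℝ) 1))

/-- [cite: ImbrieJSP2016, eq. (1.1) with (5.3)] `|E_q - E_p|` is positively homogeneous of degree one in the couplings. -/
theorem levelDiff_posHomogeneous (γ : ℝ) (n : ℕ) (p q : Cfg n) : PosHomogeneous (levelDiff γ n p q) := by
  intro c t hc
  unfold levelDiff
  have h := EigenvalueScaling.eigs_eq_smul_of_H_eq_smul γ hc.le (Params.ofTriple t) (Params.ofTriple (c • t))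
    (SmallGapDictionary.H_smul γ c t)
  rw [h, Pi.smul_apply, Pi.smul_apply, smul_eq_mul, smul_eq_mul, ← mul_sub, abs_mul, abs_of_pos hc]

/-- [cite: ImbrieJSP2016, p. 1000] `[-1,1]` pieces: `t * x ∈ [-1,1]` for `x ∈ [-1,1]`, `0 ≤ t ≤ 1`. -/
theorem mul_mem_Icc_of_mem_Icc {x t : ℝ} (hx : x ∈ Set.Icc (-1 : ℝ) 1) (ht0 : 0 ≤ t) (ht1 : t ≤ 1) :
    t * x ∈ Set.Icc (-1 : ℝ) 1 := by
  rcases hx with ⟨h1, h2⟩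
  constructor <;> nlinarith

/-- [cite: ImbrieJSP2016, p. 1000] a coordinate cube `[-1,1]^ι` is star-shaped about `0`. -/
theorem smul_mem_pi_Icc {ι : Type*} {x : ι → ℝ} (hx : x ∈ Set.univ.pi fun _ : ι => Set.Icc (-1 : ℝ) 1) {t : ℝ}
    (ht0 : 0 ≤ t) (ht1 : t ≤ 1) : t • x ∈ Set.univ.pi fun _ : ι => Set.Icc (-1 : ℝ) 1 := by
  rw [Set.mem_univ_pi] at hx ⊢
  intro i
  rw [Pi.smul_apply, smul_eq_mul]
  exact mul_mem_Icc_of_mem_Icc (hx i) ht0 ht1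

/-- [cite: ImbrieJSP2016, p. 1000] the coupling cube is star-shaped about `0`. -/
theorem cube_starShaped (n : ℕ) : StarShapedAtZero (cube n) := by
  intro x hx t ht0 ht1
  simp only [cube, Set.mem_prod] at hx ⊢
  refine ⟨?_, ?_, ?_⟩
  · simpa using smul_mem_pi_Icc hx.1 ht0 ht1
  · simpa using smul_mem_pi_Icc hx.2.1 ht0 ht1
  · simpa using smul_mem_pi_Icc hx.2.2 ht0 ht1

/-- [cite: ImbrieJSP2016, eq. (1.3) = (5.2)] FROM THE MIN-GAP LAW TO EACH PAIR: if `Leb {t ∈ cube | SmallGap γ δ t} ≤ A δ`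
for all `δ > 0`, then for every pair `p ≠ q` and every `s > 0`, `Leb {t ∈ cube | |E_q - E_p| ≤ s} ≤ A s`
(`{|E_q - E_p| ≤ s} ⊆ {SmallGap γ δ}` for every `δ > s`, then `δ ↓ s`). -/
theorem volume_subLevel_le_of_smallGap_law (γ : ℝ) (n : ℕ) {p q : Cfg n} (hpq : p ≠ q) {A : ℝ} (hA : 0 ≤ A)
    (hgap : ∀ δ : ℝ, 0 < δ →
      volume ({t : Triple n | SmallGap γ δ (Params.ofTriple t)} ∩ cube n) ≤ ENNReal.ofReal (A * δ))
    {s : ℝ} (hs : 0 < s) :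
    volume (subLevel (cube n) (levelDiff γ n p q) s) ≤ ENNReal.ofReal A * ENNReal.ofReal s := by
  have hsub : ∀ δ : ℝ, s < δ →
      subLevel (cube n) (levelDiff γ n p q) s ⊆ {t : Triple n | SmallGap γ δ (Params.ofTriple t)} ∩ cube n := by
    intro δ hδ t ht
    refine ⟨⟨q, p, fun h => hpq h.symm, ?_⟩, ht.1⟩
    have : levelDiff γ n p q t ≤ s := ht.2
    unfold levelDiff at this
    linarith
  have hlim : Tendsto (fun k : ℕ => ENNReal.ofReal (A * (s + 1 / ((k : ℝ) + 1)))) atTop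
      (𝓝 (ENNReal.ofReal A * ENNReal.ofReal s)) := by
    rw [← ENNReal.ofReal_mul hA]
    refine ENNReal.tendsto_ofReal ?_
    have h0 : Tendsto (fun k : ℕ => 1 / ((k : ℝ) + 1)) atTop (𝓝 0) := tendsto_one_div_add_atTop_nhds_zero_nat
    have h1 := (h0.const_add s).const_mul A
    rwa [add_zero] at h1
  refine ge_of_tendsto hlim (Eventually.of_forall fun k => ?_)
  have hk : (0 : ℝ) < 1 / ((k : ℝ) + 1) := by positivity
  exact (measure_mono (hsub _ (by linarith))).trans (hgap _ (by linarith))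

/-- [cite: ImbrieJSP2016, eq. (1.1), p. 1000, eq. (1.3) = (5.2)] **SHIFT-0 ⟹ ALL SHIFTS FOR THE CHAIN (1.1)** (pub-imbrie
LLA.md WE10 (d)). Hypotheses: a linear min-gap law at shift `0` for LEBESGUE measure on the coupling cube
(`Leb {t ∈ cube | SmallGap γ δ t} ≤ A δ`, all `δ > 0`; = LLA(ν = 1) for the uniform laws, up to the factor `2^(3n+1)`), an
admissible law family `L` with density bound `ρ₀ ≥ 0`, a pair `p ≠ q`, and measurability of `t ↦ |E_q(t) - E_p(t)|`.
Conclusion: for every position `a`, shift `y ≥ 0` and width `η > 0`,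
`P_L (y ≤ |E_q - E_p| ≤ y + η) ≤ ρ₀^(3n+1) · A · ((3n+1) η)`. -/
theorem boxMeasure_levelDiff_window_le {L : Laws} {ρ₀ : ℝ} (hL : L.Admissible ρ₀) (hρ : 0 ≤ ρ₀) (γ : ℝ) (a : ℤ)
    (n : ℕ) {p q : Cfg n} (hpq : p ≠ q) (hmeas : Measurable (levelDiff γ n p q)) {A : ℝ} (hA : 0 ≤ A)
    (hgap : ∀ δ : ℝ, 0 < δ →
      volume ({t : Triple n | SmallGap γ δ (Params.ofTriple t)} ∩ cube n) ≤ ENNReal.ofReal (A * δ))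
    {y η : ℝ} (hy : 0 ≤ y) (hη : 0 < η) :
    L.boxMeasure a n {t | y ≤ levelDiff γ n p q t ∧ levelDiff γ n p q t ≤ y + η}
      ≤ ENNReal.ofReal (ρ₀ ^ (3 * n + 1) * (A * ((3 * n + 1) * η))) := by
  set S := {t : Triple n | y ≤ levelDiff γ n p q t ∧ levelDiff γ n p q t ≤ y + η} with hS
  -- Step 1: admissible laws are dominated by ρ₀^(3n+1) · Lebesgue on the cube.
  have h1 := boxMeasure_apply_le hL a n S
  have hSc : S ∩ cube n = {t | t ∈ cube n ∧ y ≤ levelDiff γ n p q t ∧ levelDiff γ n p q t ≤ y + η} := by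
    ext t
    simp only [hS, cube, Set.mem_inter_iff, Set.mem_setOf_eq]
    tauto
  -- Step 2: the scaling lemma for Lebesgue measure on the coupling space.
  have hlaw : ∀ t : ℝ, 0 < t →
      volume (subLevel (cube n) (levelDiff γ n p q) t) ≤ ENNReal.ofReal A * ENNReal.ofReal t :=
    fun t ht => volume_subLevel_le_of_smallGap_law γ n hpq hA hgap ht
  have hcube : MeasurableSet (cube n) :=
    (MeasurableSet.univ_pi fun _ => measurableSet_Icc).prod
      ((MeasurableSet.univ_pi fun _ => measurableSet_Icc).prod (MeasurableSet.univ_pi fun _ => measurableSet_Icc))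
  have h2 := measure_Icc_window_le_of_shift_zero (volume : Measure (Triple n)) (cube_starShaped n)
    hcube (levelDiff_posHomogeneous γ n p q) hmeas ENNReal.ofReal_ne_top hlaw hy hη
  rw [finrank_triple] at h2
  -- Step 3: assemble.
  have hvol : (volume : Measure (Triple n)) =
      (volume : Measure (Fin n → ℝ)).prod ((volume : Measure (Fin n → ℝ)).prod (volume : Measure (Fin (n + 1) → ℝ))) :=
    rfl
  calc L.boxMeasure a n S
      ≤ ENNReal.ofReal ρ₀ ^ (3 * n + 1) * (volume : Measure (Triple n)) (S ∩ cube n) := by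
        rw [hvol]; exact h1
    _ = ENNReal.ofReal ρ₀ ^ (3 * n + 1) *
          volume {t | t ∈ cube n ∧ y ≤ levelDiff γ n p q t ∧ levelDiff γ n p q t ≤ y + η} := by rw [hSc]
    _ ≤ ENNReal.ofReal ρ₀ ^ (3 * n + 1) * (ENNReal.ofReal A * ENNReal.ofReal (((3 * n + 1 : ℕ) : ℝ) * η)) := by
        gcongr
    _ = ENNReal.ofReal (ρ₀ ^ (3 * n + 1) * (A * ((3 * n + 1) * η))) := by
        rw [← ENNReal.ofReal_pow hρ, ← ENNReal.ofReal_mul hA, ← ENNReal.ofReal_mul (pow_nonneg hρ _)]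
        push_cast
        ring_nf

end Literature.MathematicalPhysics.QuantumLattice.Imbrie2016
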